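import Literature.MathematicalPhysics.QuantumFieldTheory.Balaban1983to89.B7Prop7KernelBackgroundModulusLevels
import Literature.MathematicalPhysics.QuantumFieldTheory.Balaban1983to89.B7Prop5LineDerivFiniteFamily
import Literature.MathematicalPhysics.QuantumFieldTheory.Balaban1983to89.B9Ineq3137LocalSup
import Literature.MathematicalPhysics.QuantumFieldTheory.Balaban1983to89.B9Eq379QLipschitzGeneral

/-!
# `Balaban1983to89.B7Prop7LinearKernelBackgroundModulus` — T. Bałaban, *Averaging operations for lattice gauge theories*, Commun. Math. Phys. **98** (1985)
# 17–51 [Balaban1985Averaging] Proposition 7 p. 43 («the function Q_k(U′U₀, ηA) is analytic in complex variables A′, A … Similarly, Proposition 5 may be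
# extended to include analyticity and uniformity statements»), Proposition 5 (146)–(147) p. 40, with T. Bałaban, *Propagators for lattice gauge theories in a
# background field*, Commun. Math. Phys. **99** (1985) 389–434 [Balaban1985BackgroundPropagators] (3.79)–(3.81) p. 406: **THE KERNEL OF THE COMPOSED LINEAR
# AVERAGING `LʲηQ_j(V)(X·δ_b)(c)` IS LIPSCHITZ IN THE BACKGROUND AT A GENERAL (52)-REGULAR BASE POINT `U₀`, UNIFORMLY IN THE NUMBER OF LEVELS, WITH THE
# `L^{−jd}` LOCALITY OF (147)** — `‖LʲηQ_j(e^{B′}U₀)(Xδ_b)(c) − LʲηQ_j(U₀)(Xδ_b)(c)‖ ≤ (3∕ρ′)·β·(1 + ϑLʲ∕Lᵏ)·Lʲ·L^{−jd}·‖X‖` for `sup‖B′‖ ≤ β`, `3β ≤ ρ′`,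
# and its ℓ¹ ROW FORM `‖LʲηQ_j(e^{B′}U₀)B(c) − LʲηQ_j(U₀)B(c)‖ ≤ (3∕ρ′)·β·(1 + ϑLʲ∕Lᵏ)·Lʲ·L^{−jd}·Σ_{s ⊂ Bʲ(c₋) ∪ Bʲ(c₊)}‖B(s)‖` — a CAUCHY ESTIMATE along
# `τ ↦ e^{τB′}U₀` on r04's joint analyticity `B7Prop7Levels.prop7_analyticAt` with p06's uniform kernel bound `B7Prop5Cplx.prop5_cplx_147_uniform` as the sup on
# the disc; the general-base, linear-kernel twin of NE9-leaf-01's flat-base `B7Prop7KernelBackgroundModulusLevels` (remainder kernel) ∕ `B7Prop7BackgroundModulusLevels`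
# (values)

statement-level skeleton of published theorems with citation tags; proofs where landed; nothing here is a claim about the Yang–Mills mass gap

PDFs held: `paper:balaban1985-cmp98-averaging` (journal page = PDF page + 16; pp. 36–43 read this seat from the text layer `p0019`–`p0027`),
`paper:balaban1985-cmp99-background-propagators` (journal page = PDF page + 388; p. 406 read this seat from the text layer `p0018`).

CITATION HEADER (lean-in-tree rule).  Cell `pub-ymgap` (YM Track A, HUMAN RULING D-0062), DAG node N06 = [Balaban1985BackgroundPropagators], seat
`pub-ymgap-dag-n06-l` (gen 39; bundle F7 rows 20–21 of the N06 certificate, K1⁹ `stmt-QuantumFields-27364` SUPPORTS lane), programme «P-Q80-knit» file 1: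
the CASCADE-K K2-G junction (`B9SectBStepUParGQOfMembers.sectBStepUParGQ_of_members`, dag-n06-c) displays the averaging pair's (3.80) variation laws
`hQ80 ∕ hQL280` (block majorants of `F₂QC ∕ F₂sQC = 𝔮(e^{iηa}U) − 𝔮(U)`); at the KNIT pair (`𝔮 := QknitY = L^{−j}·linCovIterC …`, this lineage's
`B9Eq3115KnitLetterY`) their supplier is the background-Lipschitz modulus of the KERNEL of the composed linear averaging `Q_j(·)` of [5] — THIS FILE, on
`ℤ^d`, at a general base.  REUSED BY NAME, nothing restated: r04 `B7Prop7Levels.prop7_analyticAt ∕ prop7_prop4_uniform`, `B7Prop7Ck.linCovIter_cplx_csmul`,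
`B7Prop7Ins.smallness7_mono`; p06 `B7Prop5Cplx.prop5_cplx_147_uniform ∕ thetaCplx`, `B7Prop5CplxLevels.hadd_cplx_levels ∕ hsmul_cplx_levels ∕ epsCplx ∕ tauCplx`,
`B7Prop5GeneralLevels.hadd_levels ∕ hsmul_levels`, `B7Prop5LineDerivFiniteFamily.linCovIter_family`, `B9Ineq3137LocalSup.linCovIter_congr` (locality),
`B7Prop4GeneralCk.logCovIter_zero_field`, NE9-leaf-04 `B9Eq379QLipschitzGeneral.expCfg_zero_mul`, `B13Contraction113.norm_sub_le_of_sphere_bound` (Cauchy + mean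
value along `[0,1]`), `B7Prop5Flat.bump ∕ bondsIn ∕ restr ∕ insCfg ∕ agreeOn_insCfg_restr ∕ BondIn`, `B7Prop1Local.loK ∕ bondHiK ∕ AgreeOn`.

THE PRINT.  [5] p. 43: *«Another analyticity result we will need is an analyticity of Q_k(U₀, ηA) with respect to U₀. … We take U′U₀ instead of U₀,
U′ = e^{iηA′}, |A′| < α₁, and we consider the function Q_k(U′U₀, ηA). … Proposition 7. For U₀ satisfying (52) and U′ = e^{iηA′}, |A′| < α₁, α₀, α₁
sufficiently small, the function Q_k(U′U₀, ηA) is analytic in complex variables A′, A, and Proposition 4 holds uniformly in A′. Similarly, Proposition 5 may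
be extended to include analyticity and uniformity statements. The formulations are obvious.»*; p. 40 (146)–(147): *«|Q_k(U₀)A| ≦ Q_k|A| + 2C′₁α₀Q″_k|A| ≦
(1 + 2C′₁α₀)Q″_k|A|, (146) and this bound implies the required property, namely |(∂∕∂A_b)(Q_k(U₀)A)_c| = |Q_k(U₀; c, b)| ≦ 1 + 2C′₁α₀. (147)»*.  [B9] p. 406:
*«It follows from the explicit formula (124) [5] that the averaging operator Q(exp iBV) is an analytic function of B, for B sufficiently small. Moreover this
formula implies easily that Q(exp(iB)V) = Q(V) + F₂(B) and |F₂(B)B′| ≦ O(1) sup|B| Q″|B′| (3.79) … From (3.78) it follows that Q_j(U′U) depends analytically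
on A in the above domain, and we have Q_j(U′U) = Q_j(U) + F_{2,j}(A), (3.80) … |F_{2,j}(A)A′| ≦ … ≦ O(1)α₁Q″_j|A′| on Λ_j, (3.81) for Mα₀, α₁ sufficiently
small and with a constant O(1) depending on d and L only.»*  Print states ANALYTICITY in the background (Prop. 7) and the uniform kernel bound (147); the
Lipschitz MODULUS of the kernel — print's `F_{2,j}` with its `Q″_j` (block-ℓ¹, `L^{−jd}`-normalised) shape — follows by a Cauchy estimate: the cell's reading
(NE9-leaf-01 ∕ -04 at the flat base), here at a general base so that it serves a CURVED background `U` of the class (3.35).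

WHAT IS PROVED (sorry-free; 0 `def`; no `Prop` placeholder; hypotheses = r04∕p06's displayed Prop.-7∕Prop.-5 regime at a background-perturbation
radius `ρ′` and a field radius `ρ`, and (52) for the `G`-valued base `U₀` at scale `k`).
* §1 the bump decomposition `insCfg_restr_eq_sum'` of a field restricted to a finite bond set (general `𝔸`; twin of dag-n06-l g36's `CStarAlgebra` lemma).
* §2 `hasDerivAt_logCovIter_line_at` — (134) along a complex line at the complex background `e^{B′}U₀` over a GENERAL base, every `j ≤ k`:
  `d∕ds Q_j(e^{B′}U₀, sD)(c)|₀ = LʲηQ_j(e^{B′}U₀)D(c)` (general-base twin of leaf-01's `hasDerivAt_logCovIter_line`).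
* §3 `analyticAt_linCovIter_background_line` — THE LINEAR KERNEL ENTRY `τ ↦ LʲηQ_j(e^{τX′}U₀)D(c)` IS ANALYTIC on the disc `‖τX′‖ ≤ ρ′`: it is the `∂_s`-slice at
  `s = 0` of the jointly analytic `(τ, s) ↦ Q_j(e^{τX′}U₀, sD)(c)` (`prop7_analyticAt` with parameter space `ℂ × ℂ`, then `AnalyticAt.fderiv`).
* §4 ★★ `norm_linCovIter_bump_sub_base_le` — THE KERNEL MODULUS at a general base (statement in the title), for every `j ≤ k`, `ϑ = thetaCplx d L α₀ k ρ′`;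
  `linCovIter_bump_sub_base_eq_zero_off` — the difference VANISHES unless `b ⊂ Bʲ(c₋) ∪ Bʲ(c₊)` ((147)'s locality clause at both backgrounds).
* §5 ★★★ `norm_linCovIter_sub_base_le_sum` — THE ℓ¹ ROW FORM (print's (3.81) shape `O(1)·α₁·Q″_j|A′|` on `ℤ^d`, `α₁ ↔ β` up to the exponential chart): the field
  restricted to the double box is a finite sum of bumps (locality `linCovIter_congr`), the composite is additive over it at BOTH backgrounds (`linCovIter_family`
  with the one-step binders `hadd_levels ∕ hsmul_levels` resp. `hadd_cplx_levels ∕ hsmul_cplx_levels`), and §4 bounds each term.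

HONEST SCOPE ∕ DECLARED READINGS.  (i) [folklore] Cauchy estimates on LANDED analyticity ∕ bounds; crude constants (`3∕ρ′`, not print's sharp `O(1)` of
(3.79)); every threshold is r04∕p06's explicit `d`-dependent witness of «α₀, α₁ sufficiently small», DISPLAYED, not chosen here.  (ii) The perturbation is
`e^{B′}` with `sup‖B′‖ ≤ β ≤ ρ′∕3` (print: `U′ = e^{iηA′}`, `|A′| < α₁(Lʲη)^{−1}`; `Lᵏβ` plays `α₁`); the base `U₀` is `G`-valued, `G` averaging-closed
unit-bounded, in (52) at scale `k` — at the knit letter this is the RETRACTION of the member field to the double block (file 2 of the programme), not the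
member field itself.  (iii) `ℤ^d`, corner blocks, un-normalised composite `LʲηQ_j` (the lineage's conventions).  NOT CLAIMED: (3.80)'s telescoping identity
(typed abstractly in pv27's `B9Eq380Telescope`, not needed on the Cauchy route); the adjoint `F*_{2,j}`; anything at the torus ∕ member level (file 2).
Count-neutral; N06 NOT discharged; K1⁹ NOT closed; nothing continuum ∕ ℝ⁴ ∕ OS ∕ mass gap ∕ Clay — the Yang–Mills mass gap is NOT proved here.  NEW file;
nothing landed is modified.  No `sorry`, no `axiom`, no `def`, no `instance`, no `notation`.  Net new unproved facts: 0.
-/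

noncomputable section

open scoped BigOperators
open NormedSpace Metric Set

namespace Literature.MathematicalPhysics.QuantumFieldTheory.Balaban1983to89.B7Prop7LinearKernelBackgroundModulus

open B7Prop1Explicit B7Prop2Explicit B7Prop3Flat MatrixLog B7Prop3GeneralLinear B7Prop4GeneralLevels B7Prop7Levels B7Prop7Ins
open B7Prop1Local (loK bondHiK AgreeOn)
open B7Prop5Flat (bump BondIn bondsIn restr mem_bondsIn agreeOn_insCfg_restr bump_eq_zero_of)
open B7Prop4GeneralCk (logCovIter_zero_field)
open B7Prop7Ck (linCovIter_cplx_csmul)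
open B7Prop5CplxLevels (epsCplx tauCplx hadd_cplx_levels hsmul_cplx_levels)
open B7Prop5Cplx (thetaCplx thetaCplx_nonneg prop5_cplx_147_uniform)
open B7Prop5GeneralLevels (hadd_levels hsmul_levels)
open B7Prop5LineDerivFiniteFamily (linCovIter_family)
open B13Contraction113 (norm_sub_le_of_sphere_bound)
open B9Eq379QLipschitzGeneral (expCfg_zero_mul)
open B9Ineq3137LocalSup (linCovIter_congr)

export B7Prop1Explicit (Site)

variable {d : ℕ} {𝔸 : Type*} [NormedRing 𝔸] [NormedAlgebra ℂ 𝔸] [CompleteSpace 𝔸] [NormOneClass 𝔸]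

/-! ## §1 Bookkeeping: the bump decomposition of a field restricted to a finite bond set -/

omit [NormedAlgebra ℂ 𝔸] [CompleteSpace 𝔸] [NormOneClass 𝔸] in
/-- the sum of the single-bond bumps of a field over a finite bond set, evaluated at a member bond. [cite: Balaban1985Averaging, p.24 (after (43)), bookkeeping] -/
theorem sum_bump_apply_of_mem' {S : Finset (Site d × Fin d)} (F : Site d → Fin d → 𝔸) {x : Site d} {κ : Fin d}
    (h : (x, κ) ∈ S) : (∑ s ∈ S, bump s.1 s.2 (F s.1 s.2)) x κ = F x κ := by
  classical
  rw [Finset.sum_apply, Finset.sum_apply, Finset.sum_eq_single (x, κ)]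
  · simp [bump]
  · rintro ⟨x', κ'⟩ _ hne
    rw [bump_eq_zero_of]
    rintro ⟨rfl, rfl⟩
    exact hne rfl
  · intro hn; exact absurd h hn

omit [NormedAlgebra ℂ 𝔸] [CompleteSpace 𝔸] [NormOneClass 𝔸] in
/-- … and at a non-member bond it vanishes. [cite: Balaban1985Averaging, p.24 (after (43)), bookkeeping] -/
theorem sum_bump_apply_of_not_mem' {S : Finset (Site d × Fin d)} (F : Site d → Fin d → 𝔸) {x : Site d} {κ : Fin d}
    (h : (x, κ) ∉ S) : (∑ s ∈ S, bump s.1 s.2 (F s.1 s.2)) x κ = 0 := by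
  classical
  rw [Finset.sum_apply, Finset.sum_apply]
  refine Finset.sum_eq_zero fun s hs => ?_
  rw [bump_eq_zero_of]
  rintro ⟨rfl, rfl⟩
  exact h hs

omit [CompleteSpace 𝔸] [NormOneClass 𝔸] in
/-- the restriction of a bond field to a finite bond set is the finite sum of its single-bond bumps. [cite: Balaban1985Averaging, p.24 (after (43)), bookkeeping] -/
theorem insCfg_restr_eq_sum' (S : Finset (Site d × Fin d)) (B : Site d → Fin d → 𝔸) :
    insCfg S (restr S B) = (0 : Site d → Fin d → 𝔸) + ∑ s ∈ S, (1 : ℂ) • bump s.1 s.2 (B s.1 s.2) := by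
  classical
  funext x κ
  rw [zero_add]
  simp only [one_smul]
  by_cases h : (x, κ) ∈ S
  · rw [sum_bump_apply_of_mem' B h]
    simp [insCfg, restr, h]
  · rw [sum_bump_apply_of_not_mem' B h]
    simp [insCfg, h]

/-! ## §2 (134) at `A = 0` along a complex line, at the complex background `e^{B′}U₀` over a general base -/

section Main

variable (L : ℕ) (hL : 2 ≤ L) {G : Subgroup 𝔸ˣ} (hG : AvgClosed d L G) (k : ℕ)
  (U₀ : Site d → Fin d → 𝔸ˣ) (hU₀ : ∀ x κ, U₀ x κ ∈ G) {α₀ : ℝ} (hα : 0 < α₀)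
  (hα3 : C0 d * α₀ ≤ 1 / 3) (hα8 : 8 * α₀ ≤ c2' d L) (h52 : pdev U₀ < α₀ * (((L : ℝ) ^ k)⁻¹) ^ 2)
  {ρ' ρ : ℝ} (hρ' : 0 < ρ') (hρ : 0 < ρ)
  -- Prop. 7's regime in the background variable `‖B′‖ ≤ ρ′` ((130)∕(131), (164))
  (hsmall' : Real.exp (4 * (800 * ((d : ℝ) + 1) ^ 2 * ((d : ℝ) + 4)) * α₀)
    * (1 + 8 * (131072 * ((d : ℝ) + 1) ^ 2) * ((L : ℝ) ^ k * ρ')) ≤ 2)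
  (hc₃' : 2 * ((L : ℝ) ^ k * ρ') ≤ c3 d L) (hρ'1 : 409600 * ((d : ℝ) + 1) ^ 2 * ((L : ℝ) ^ k * ρ') ≤ 1)
  -- Prop. 5's complex regime at the perturbation radius `ρ′` (the step condition (145) «α₀, α₁ sufficiently small»)
  (hE : epsCplx d L ρ' k ≤ 1 / 16) (hdX : (d : ℝ) * (epsCplx d L ρ' k + tauCplx d L α₀ k ρ' k) ≤ 1 / 16)
  -- a field radius `ρ` in Prop. 7's regime (only its existence is used: the kernel entries are derivatives at the zero field)
  (hsmall : Real.exp (4480 * ((d : ℝ) + 1) ^ 2 * ((d : ℝ) + 4) * α₀ + 240000 * ((d : ℝ) + 1) ^ 3 * ((L : ℝ) ^ k * ρ'))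
    * (1 + 8 * (2097152 * ((d : ℝ) + 1) ^ 2) * ((L : ℝ) ^ k * ρ)) ≤ 2)
  (hc₃ : 2 * ((L : ℝ) ^ k * ρ) ≤ c3 d L / 4)

include hL hG hU₀ hα hα3 hα8 h52 hρ hsmall' hc₃' hρ'1 hsmall hc₃ in
/-- **`d∕ds Q_j(e^{B′}U₀, sD)(c)|_{s=0} = LʲηQ_j(e^{B′}U₀)D(c)`**, every `j ≤ k`, for every direction `D` with `‖D(b)‖ ≤ δ` and every perturbation `sup‖B′‖ ≤ b′ ≤ ρ′`
of a GENERAL (52)-regular `G`-valued base `U₀` — (130) along the line `s ↦ sD` («Proposition 4 holds uniformly in A′», `prop7_prop4_uniform`) and the homogeneity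
`linCovIter_cplx_csmul`; the general-base twin of NE9-leaf-01's `B7Prop7BackgroundModulusLevels.hasDerivAt_logCovIter_line`. [folklore]
[cite: Balaban1985Averaging, Proposition 7 p.43, (130) p.38, (134) p.38] -/
theorem hasDerivAt_logCovIter_line_at (B' : Site d → Fin d → 𝔸) {b' : ℝ} (hb' : 0 ≤ b') (hB' : ∀ x κ, ‖B' x κ‖ ≤ b') (hb'ρ : b' ≤ ρ')
    (D : Site d → Fin d → 𝔸) {δ : ℝ} (hδ : 0 ≤ δ) (hD : ∀ x κ, ‖D x κ‖ ≤ δ) {j : ℕ} (hj : j ≤ k) (z : Site d) (κ : Fin d) :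
    HasDerivAt (fun t : ℂ => logCovIter L (expCfg B' * U₀) (t • D) j z κ) (linCovIter L (expCfg B' * U₀) D j z κ) 0 := by
  obtain ⟨hs', hc', h1', -, -⟩ := smallness7_mono (d := d) (L := L) (k := k) (α₀ := α₀) hb'ρ le_rfl hρ.le hsmall' hc₃' hρ'1 hsmall hc₃
  set K : ℝ := 8 * (2097152 * ((d : ℝ) + 1) ^ 2)
    * Real.exp (4480 * ((d : ℝ) + 1) ^ 2 * ((d : ℝ) + 4) * α₀ + 240000 * ((d : ℝ) + 1) ^ 3 * ((L : ℝ) ^ k * b')) with hK_def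
  have hK0 : 0 ≤ K := by positivity
  have hL1r : (1 : ℝ) ≤ L := by exact_mod_cast le_trans (by norm_num) hL
  have hLjk : (L : ℝ) ^ j ≤ (L : ℝ) ^ k := pow_le_pow_right₀ hL1r hj
  rw [hasDerivAt_iff_isLittleO_nhds_zero]
  have h0 : logCovIter L (expCfg B' * U₀) ((0 : ℂ) • D) j z κ = 0 := by
    rw [zero_smul, logCovIter_zero_field L (expCfg B' * U₀) j]; rfl
  refine (Asymptotics.IsBigO.of_bound (K * ((L : ℝ) ^ k * δ) ^ 2) ?_).trans_isLittleO (Asymptotics.isLittleO_pow_id (one_lt_two))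
  rw [Metric.eventually_nhds_iff]
  refine ⟨ρ / (δ + 1), by positivity, fun h hh => ?_⟩
  rw [dist_zero_right] at hh
  have hb : ‖h‖ * δ ≤ ρ := by
    have hv1 : (0 : ℝ) < δ + 1 := by positivity
    have h1 : ‖h‖ * (δ + 1) ≤ ρ := ((lt_div_iff₀ hv1).1 hh).le
    nlinarith [norm_nonneg h]
  obtain ⟨-, -, -, hs, hc⟩ := smallness7_mono (d := d) (L := L) (k := k) (α₀ := α₀) hb'ρ (mul_nonneg (norm_nonneg h) hδ) hb hsmall' hc₃' hρ'1 hsmall hc₃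
  have hbnd : ∀ x κ', ‖(h • D) x κ'‖ ≤ ‖h‖ * δ := fun x κ' => by
    rw [Pi.smul_apply, Pi.smul_apply, norm_smul]; exact mul_le_mul_of_nonneg_left (hD x κ') (norm_nonneg h)
  have hEst := (prop7_prop4_uniform L hL hG k U₀ hU₀ hα hα3 hα8 h52 B' hb' hB' hs' hc' h1' (h • D) (by positivity) hbnd hs hc j hj).1
  have hlin : h • linCovIter L (expCfg B' * U₀) D j z κ = linCovIter L (expCfg B' * U₀) (h • D) j z κ := by
    rw [linCovIter_cplx_csmul L hL hG k U₀ hU₀ hα hα3 hα8 h52 B' hb' hB' hs' hc' h1' h D j hj, Pi.smul_apply, Pi.smul_apply]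
  rw [zero_add, h0, sub_zero, hlin, norm_pow]
  have hδh : 0 ≤ ‖h‖ * δ := mul_nonneg (norm_nonneg h) hδ
  calc ‖logCovIter L (expCfg B' * U₀) (h • D) j z κ - linCovIter L (expCfg B' * U₀) (h • D) j z κ‖
      ≤ K * ((L : ℝ) ^ j * (‖h‖ * δ)) ^ 2 := by rw [hK_def]; exact hEst z κ
    _ ≤ K * ((L : ℝ) ^ k * (‖h‖ * δ)) ^ 2 := by
        refine mul_le_mul_of_nonneg_left ?_ hK0
        have h1 : (L : ℝ) ^ j * (‖h‖ * δ) ≤ (L : ℝ) ^ k * (‖h‖ * δ) := mul_le_mul_of_nonneg_right hLjk hδh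
        have h2 : 0 ≤ (L : ℝ) ^ j * (‖h‖ * δ) := by positivity
        exact pow_le_pow_left₀ h2 h1 2
    _ = K * ((L : ℝ) ^ k * δ) ^ 2 * ‖h‖ ^ 2 := by ring

/-! ## §3 The linear kernel entry is analytic in the background variable -/

include hL hG hU₀ hα hα3 hα8 h52 hρ' hρ hsmall' hc₃' hρ'1 hsmall hc₃ in
/-- **THE LINEAR KERNEL ENTRY `τ ↦ LʲηQ_j(e^{τX′}U₀)D(c)` IS ANALYTIC ON THE DISC `‖τX′‖ ≤ ρ′`**, every `j ≤ k`, every bounded direction `D`: at each `τ′` of the disc the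
entry is `∂_s Q_j(e^{τ′X′}U₀, sD)(c)|₀` (§2), the map `(τ, s) ↦ Q_j(e^{τX′}U₀, sD)(c)` being jointly analytic on `ℂ²` near `(τ′, 0)` (`prop7_analyticAt`, parameter space
`ℂ × ℂ`, field size `0` at the base point); hence the entry is the `∂_s`-slice of an analytic map, analytic in `τ` (`AnalyticAt.fderiv`).  (Linear-kernel twin of
NE9-leaf-01's `analyticAt_dCov_background_line`, at a general base.) [folklore] [cite: Balaban1985Averaging, Proposition 7 p.43, (134) p.38, (147) p.40] -/
theorem analyticAt_linCovIter_background_line (X' : Site d → Fin d → 𝔸) {R : ℝ} (hXR : ∀ τ : ℂ, ‖τ‖ < R → ∀ x κ, ‖(τ • X') x κ‖ ≤ ρ')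
    (D : Site d → Fin d → 𝔸) {δ : ℝ} (hδ : 0 ≤ δ) (hD : ∀ x κ, ‖D x κ‖ ≤ δ) {j : ℕ} (hj : j ≤ k) (z : Site d) (κ : Fin d)
    {τ : ℂ} (hτ : ‖τ‖ < R) :
    AnalyticAt ℂ (fun τ' : ℂ => linCovIter L (expCfg (τ' • X') * U₀) D j z κ) τ := by
  obtain ⟨-, -, -, hs0, hc0⟩ := smallness7_mono (d := d) (L := L) (k := k) (α₀ := α₀) (le_refl ρ') le_rfl hρ.le hsmall' hc₃' hρ'1 hsmall hc₃
  -- the jointly analytic map `H(τ, s) = Q_j(e^{τX′}U₀, sD)(c)`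
  set H : ℂ × ℂ → 𝔸 := fun t => logCovIter L (expCfg (t.1 • X') * U₀) (t.2 • D) j z κ with hH
  have hA : ∀ τ' : ℂ, ‖τ'‖ < R → AnalyticAt ℂ H (τ', 0) := fun τ' hτ' =>
    prop7_analyticAt L hL hG k U₀ hU₀ hα hα3 hα8 h52 (E := ℂ × ℂ) (fun t : ℂ × ℂ => t.1 • X') (t₀ := (τ', 0))
      (fun x κ' => (analyticAt_fst.smul analyticAt_const : AnalyticAt ℂ (fun t : ℂ × ℂ => (t.1 • X') x κ') (τ', 0))) hρ'.le (hXR τ' hτ')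
      hsmall' hc₃' hρ'1 (fun t : ℂ × ℂ => t.2 • D)
      (fun x κ' => (analyticAt_snd.smul analyticAt_const : AnalyticAt ℂ (fun t : ℂ × ℂ => (t.2 • D) x κ') (τ', 0)))
      le_rfl (fun x κ' => by simp) hs0 hc0 j hj z κ
  -- the curve `s ↦ (τ′, s)`
  have hcurve : ∀ τ' : ℂ, HasDerivAt (fun s : ℂ => ((τ', s) : ℂ × ℂ)) ((0 : ℂ), (1 : ℂ)) 0 := fun τ' =>
    (hasDerivAt_const (0 : ℂ) τ').prodMk (hasDerivAt_id (0 : ℂ))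
  -- the entry as the `∂_s`-slice, on the whole disc
  have hEq : ∀ τ' : ℂ, ‖τ'‖ < R → linCovIter L (expCfg (τ' • X') * U₀) D j z κ = (fderiv ℂ H (τ', 0)) (0, 1) := by
    intro τ' hτ'
    have hd : HasDerivAt (fun s : ℂ => logCovIter L (expCfg (τ' • X') * U₀) (s • D) j z κ) (linCovIter L (expCfg (τ' • X') * U₀) D j z κ) 0 :=
      hasDerivAt_logCovIter_line_at L hL hG k U₀ hU₀ hα hα3 hα8 h52 hρ hsmall' hc₃' hρ'1 hsmall hc₃ (τ' • X') hρ'.le (hXR τ' hτ') le_rfl D hδ hD hj z κ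
    have hd' : HasDerivAt (fun s : ℂ => logCovIter L (expCfg (τ' • X') * U₀) (s • D) j z κ) ((fderiv ℂ H (τ', 0)) (0, 1)) 0 := by
      have h := ((hA τ' hτ').differentiableAt.hasFDerivAt.comp_hasDerivAt (0 : ℂ) (hcurve τ'))
      simp only [hH, Function.comp_def] at h
      exact h
    exact hd.unique hd'
  -- analyticity of the slice in `τ′`
  have hS : AnalyticAt ℂ (fun τ' : ℂ => (fderiv ℂ H (τ', 0)) (0, 1)) τ := by
    have hf : AnalyticAt ℂ (fun τ' : ℂ => ((τ', (0 : ℂ)) : ℂ × ℂ)) τ := analyticAt_id.prod analyticAt_const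
    have h1 : AnalyticAt ℂ ((fderiv ℂ H) ∘ (fun τ' : ℂ => ((τ', (0 : ℂ)) : ℂ × ℂ))) τ := (hA τ hτ).fderiv.comp_of_eq hf rfl
    exact ((ContinuousLinearMap.apply ℂ 𝔸 ((0 : ℂ), (1 : ℂ))).analyticAt _).comp h1
  have hev : (fun τ' : ℂ => linCovIter L (expCfg (τ' • X') * U₀) D j z κ) =ᶠ[nhds τ] fun τ' : ℂ => (fderiv ℂ H (τ', 0)) (0, 1) := by
    filter_upwards [isOpen_ball.mem_nhds (mem_ball_zero_iff.2 hτ)] with τ' hτ'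
    exact hEq τ' (mem_ball_zero_iff.1 hτ')
  exact hS.congr hev.symm

/-! ## §4 The kernel is Lipschitz in the background at the general base, with the `L^{−jd}` of (147) -/

include hL hG hU₀ hα hα3 hα8 h52 hρ' hρ hsmall' hc₃' hρ'1 hE hdX hsmall hc₃ in
/-- ★★ **THE KERNEL MODULUS AT A GENERAL BASE — `‖LʲηQ_j(e^{B′}U₀)(Xδ_b)(c) − LʲηQ_j(U₀)(Xδ_b)(c)‖ ≤ (3∕ρ′)·β·(1 + ϑ·Lʲ∕Lᵏ)·Lʲ·L^{−jd}·‖X‖`** for `sup‖B′‖ ≤ β` with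
`3β ≤ ρ′`, every `j ≤ k`, every unit-lattice bond `b = ⟨y, y + e_μ⟩`, `X ∈ 𝔸` and bond `c = ⟨z, z + e_κ⟩` of the `j`-th lattice (`ϑ = thetaCplx d L α₀ k ρ′`, p06's
«1 + 2C′₁α₀» at the complex background of size `ρ′`): Prop. 7's analyticity in the background read as a LIPSCHITZ MODULUS OF THE KERNEL — `g(τ) =
LʲηQ_j(e^{τB′}U₀)(Xδ_b)(c)` is analytic on `|τ| < R := ρ′∕β` (§3) with the uniform bound (147) `‖g(τ)‖ ≤ M := (1 + ϑLʲ∕Lᵏ)·Lʲ·L^{−jd}·‖X‖` there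
(`prop5_cplx_147_uniform` at `b′ := ρ′`); Cauchy on circles of radius `R − 2 ≥ R∕3` around `[0, 1]` (`norm_sub_le_of_sphere_bound`) gives `‖g(1) − g(0)‖ ≤
M∕(R − 2) ≤ 3M∕R = (3∕ρ′)·β·M`.  This is [B9]'s `|F_{2,j}(A)(c, b)| ≦ O(1)·α₁·L^{−jd}` entrywise, at a curved base. [folklore]
[cite: Balaban1985Averaging, Proposition 7 p.43, (147) p.40; Balaban1985BackgroundPropagators, (3.79)–(3.81) p.406] -/
theorem norm_linCovIter_bump_sub_base_le (B' : Site d → Fin d → 𝔸) {β : ℝ} (hβ : 0 ≤ β) (hB' : ∀ x κ, ‖B' x κ‖ ≤ β) (hβρ : 3 * β ≤ ρ')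
    (y : Site d) (μ : Fin d) (X : 𝔸) {j : ℕ} (hj : j ≤ k) (z : Site d) (κ : Fin d) :
    ‖linCovIter L (expCfg B' * U₀) (bump y μ X) j z κ - linCovIter L U₀ (bump y μ X) j z κ‖ ≤
      3 / ρ' * β * ((1 + thetaCplx d L α₀ k ρ' * ((L : ℝ) ^ j * ((L : ℝ) ^ k)⁻¹)) * ((L : ℝ) ^ j * (((L : ℝ) ^ j) ^ d)⁻¹) * ‖X‖) := by
  set M : ℝ := (1 + thetaCplx d L α₀ k ρ' * ((L : ℝ) ^ j * ((L : ℝ) ^ k)⁻¹)) * ((L : ℝ) ^ j * (((L : ℝ) ^ j) ^ d)⁻¹) * ‖X‖ with hMdef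
  have hϑ : 0 ≤ thetaCplx d L α₀ k ρ' * ((L : ℝ) ^ j * ((L : ℝ) ^ k)⁻¹) := mul_nonneg (thetaCplx_nonneg d L hα.le k hρ'.le) (by positivity)
  have hM0 : 0 ≤ M := by rw [hMdef]; positivity
  rcases hβ.eq_or_lt with h0 | hpos
  · -- `β = 0`: the perturbation IS trivial
    have hB0 : B' = 0 := by
      funext x κ'
      have h := hB' x κ'
      rw [← h0] at h
      simpa using norm_le_zero_iff.1 h
    rw [hB0, expCfg_zero_mul, sub_self, norm_zero, ← h0]; positivity
  -- the radius of analyticity in the background variable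
  set R : ℝ := ρ' / β with hRdef
  have hR : 0 < R := by rw [hRdef]; positivity
  have hR3 : 3 ≤ R := by rw [hRdef, le_div_iff₀ hpos]; linarith
  have hτX : ∀ τ : ℂ, ‖τ‖ < R → ∀ x κ', ‖(τ • B') x κ'‖ ≤ ρ' := fun τ hτ x κ' => by
    rw [Pi.smul_apply, Pi.smul_apply, norm_smul]
    calc ‖τ‖ * ‖B' x κ'‖ ≤ R * β := mul_le_mul hτ.le (hB' x κ') (norm_nonneg _) hR.le
      _ = ρ' := by rw [hRdef]; field_simp
  -- the family `g(τ) = LʲηQ_j(e^{τB′}U₀)(Xδ_b)(c)`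
  set g : ℂ → 𝔸 := fun τ => linCovIter L (expCfg (τ • B') * U₀) (bump y μ X) j z κ with hgdef
  have g1 : g 1 = linCovIter L (expCfg B' * U₀) (bump y μ X) j z κ := by simp only [hgdef, one_smul]
  have g0 : g 0 = linCovIter L U₀ (bump y μ X) j z κ := by simp only [hgdef, zero_smul, expCfg_zero_mul]
  -- the bump direction is bounded by `‖X‖`
  have hDn : ∀ x κ', ‖bump y μ X x κ'‖ ≤ ‖X‖ := fun x κ' => by
    unfold bump; split_ifs <;> simp
  -- analyticity on the disc (§3)
  have hd : DifferentiableOn ℂ g (ball (0 : ℂ) R) := fun τ hτ =>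
    (analyticAt_linCovIter_background_line L hL hG k U₀ hU₀ hα hα3 hα8 h52 hρ' hρ hsmall' hc₃' hρ'1 hsmall hc₃ B' hτX (bump y μ X) (norm_nonneg X)
      hDn hj z κ (mem_ball_zero_iff.1 hτ)).differentiableAt.differentiableWithinAt
  -- the uniform bound (147) on the disc
  have hMb : ∀ τ : ℂ, ‖τ‖ < R → ‖g τ‖ ≤ M := fun τ hτ =>
    (prop5_cplx_147_uniform L hL hG k U₀ hU₀ hα hα3 hα8 h52 (τ • B') hρ'.le (hτX τ hτ) hsmall' hc₃' hρ'1 hE hdX y μ X hj z κ).1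
  -- Cauchy on circles of radius `R − 2` around `[0, 1]`
  have hr : 0 < R - 2 := by linarith
  have hsub : ∀ t : ℝ, t ∈ Icc (0 : ℝ) 1 → closedBall (t : ℂ) (R - 2) ⊆ ball (0 : ℂ) R := fun t ht w hw => by
    rw [mem_closedBall, dist_eq_norm] at hw
    rw [mem_ball_zero_iff]
    have ht1 : ‖(t : ℂ)‖ ≤ 1 := by rw [Complex.norm_real, Real.norm_of_nonneg ht.1]; exact ht.2
    calc ‖w‖ = ‖(w - t) + t‖ := by rw [sub_add_cancel]
      _ ≤ ‖w - (t : ℂ)‖ + ‖(t : ℂ)‖ := norm_add_le _ _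
      _ < R := by linarith
  have hMs : ∀ t : ℝ, t ∈ Icc (0 : ℝ) 1 → ∀ w ∈ sphere (t : ℂ) (R - 2), ‖g w‖ ≤ M := fun t ht w hw =>
    hMb w (mem_ball_zero_iff.1 (hsub t ht (sphere_subset_closedBall hw)))
  have hC := norm_sub_le_of_sphere_bound isOpen_ball hd hr hsub hMs
  rw [g1, g0] at hC
  refine hC.trans ?_
  have hR2 : R / 3 ≤ R - 2 := by linarith
  calc M / (R - 2) ≤ M / (R / 3) := div_le_div_of_nonneg_left hM0 (by positivity) hR2
    _ = 3 / ρ' * β * M := by rw [hRdef]; field_simp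

include hL hG hU₀ hα hα3 hα8 h52 hρ' hsmall' hc₃' hρ'1 hE hdX in
/-- **LOCALITY OF THE DIFFERENCE**: the kernel entries at `e^{B′}U₀` and at `U₀` both vanish unless `b ⊂ Bʲ(c₋) ∪ Bʲ(c₊)` ((147) «zero unless …», `prop5_cplx_147_uniform`
at `B′` and at `B′ := 0`), hence so does their difference. [folklore] [cite: Balaban1985Averaging, (147) p.40, (141) p.39] -/
theorem linCovIter_bump_sub_base_eq_zero_off (B' : Site d → Fin d → 𝔸) (hB' : ∀ x κ, ‖B' x κ‖ ≤ ρ')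
    (y : Site d) (μ : Fin d) (X : 𝔸) {j : ℕ} (hj : j ≤ k) (z : Site d) (κ : Fin d)
    (hoff : ¬ BondIn (loK L j z) (bondHiK L j z κ) y μ) :
    linCovIter L (expCfg B' * U₀) (bump y μ X) j z κ - linCovIter L U₀ (bump y μ X) j z κ = 0 := by
  have h0' : ∀ x κ', ‖(0 : Site d → Fin d → 𝔸) x κ'‖ ≤ ρ' := fun _ _ => by simpa using hρ'.le
  have hV := (prop5_cplx_147_uniform L hL hG k U₀ hU₀ hα hα3 hα8 h52 B' hρ'.le hB' hsmall' hc₃' hρ'1 hE hdX y μ X hj z κ).2 hoff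
  have h1 := (prop5_cplx_147_uniform L hL hG k U₀ hU₀ hα hα3 hα8 h52 0 hρ'.le h0' hsmall' hc₃' hρ'1 hE hdX y μ X hj z κ).2 hoff
  rw [expCfg_zero_mul] at h1
  rw [hV, h1, sub_zero]

/-! ## §5 The ℓ¹ row form: print's (3.81) shape on `ℤ^d` at a curved base -/

include hL hG hU₀ hα hα3 hα8 h52 hρ' hρ hsmall' hc₃' hρ'1 hE hdX hsmall hc₃ in
/-- ★★★ **THE ℓ¹ ROW FORM — `‖LʲηQ_j(e^{B′}U₀)B(c) − LʲηQ_j(U₀)B(c)‖ ≤ (3∕ρ′)·β·(1 + ϑ·Lʲ∕Lᵏ)·Lʲ·L^{−jd}·Σ_{s ⊂ Bʲ(c₋) ∪ Bʲ(c₊)}‖B(s)‖`** for `sup‖B′‖ ≤ β`, `3β ≤ ρ′`,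
every `j ≤ k` and EVERY bond field `B` (no size condition: both sides are linear in `B`) — print's `|F_{2,j}(A)A′| ≦ O(1)·α₁·Q″_j|A′|` (3.81) on `ℤ^d` at a curved
base: both composites read `B` only on the double box (`linCovIter_congr`), where `B` is the finite sum of its single-bond bumps (§1); both are additive over that
sum (`linCovIter_family`, one-step binders `hadd_levels ∕ hsmul_levels` at `U₀` and `hadd_cplx_levels ∕ hsmul_cplx_levels` at `e^{B′}U₀`); §4 bounds each term.
[folklore] [cite: Balaban1985BackgroundPropagators, (3.80)–(3.81) p.406; Balaban1985Averaging, Proposition 7 p.43, (146)–(147) p.40, (141) p.39] -/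
theorem norm_linCovIter_sub_base_le_sum (B' : Site d → Fin d → 𝔸) {β : ℝ} (hβ : 0 ≤ β) (hB' : ∀ x κ, ‖B' x κ‖ ≤ β) (hβρ : 3 * β ≤ ρ')
    (B : Site d → Fin d → 𝔸) {j : ℕ} (hj : j ≤ k) (z : Site d) (κ : Fin d) :
    ‖linCovIter L (expCfg B' * U₀) B j z κ - linCovIter L U₀ B j z κ‖ ≤
      3 / ρ' * β * ((1 + thetaCplx d L α₀ k ρ' * ((L : ℝ) ^ j * ((L : ℝ) ^ k)⁻¹)) * ((L : ℝ) ^ j * (((L : ℝ) ^ j) ^ d)⁻¹)) *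
        ∑ s ∈ bondsIn (loK L j z) (bondHiK L j z κ), ‖B s.1 s.2‖ := by
  classical
  have hL1 : 1 ≤ L := le_trans (by norm_num) hL
  have hα4 : 4 * α₀ ≤ c2' d L := by linarith
  have hβρ' : β ≤ ρ' := by linarith
  obtain ⟨hs', hc', h1', -, -⟩ := smallness7_mono (d := d) (L := L) (k := k) (α₀ := α₀) hβρ' le_rfl hρ.le hsmall' hc₃' hρ'1 hsmall hc₃
  set S := bondsIn (loK L j z) (bondHiK L j z κ) with hS
  -- restrict the field to the double box, at both backgrounds
  have hloc : ∀ V : Site d → Fin d → 𝔸ˣ, linCovIter L V B j z κ = linCovIter L V (insCfg S (restr S B)) j z κ := fun V =>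
    linCovIter_congr L hL1 j z κ (fun _ _ _ _ => rfl) (agreeOn_insCfg_restr _ _ B)
  -- additivity over the bump decomposition, at both backgrounds
  have hfam : ∀ V : Site d → Fin d → 𝔸ˣ,
      (∀ j' < k, ∀ (F F' : Site d → Fin d → 𝔸) (z' : Site d) (κ' : Fin d),
        linQcov L (avgIter L V j') (F + F') ((L : ℤ) • z') κ' = linQcov L (avgIter L V j') F ((L : ℤ) • z') κ' + linQcov L (avgIter L V j') F' ((L : ℤ) • z') κ') →
      (∀ j' < k, ∀ (t : ℂ) (F : Site d → Fin d → 𝔸) (z' : Site d) (κ' : Fin d),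
        linQcov L (avgIter L V j') (t • F) ((L : ℤ) • z') κ' = t • linQcov L (avgIter L V j') F ((L : ℤ) • z') κ') →
      linCovIter L V (0 : Site d → Fin d → 𝔸) j z κ = 0 →
      linCovIter L V B j z κ = ∑ s ∈ S, linCovIter L V (bump s.1 s.2 (B s.1 s.2)) j z κ := by
    intro V hadd hsmul hzero
    rw [hloc V, insCfg_restr_eq_sum' S B,
      linCovIter_family L V k hadd hsmul S (fun _ => (1 : ℂ)) (fun s => bump s.1 s.2 (B s.1 s.2)) 0 j hj z κ, hzero, zero_add]
    exact Finset.sum_congr rfl fun s _ => by rw [one_smul]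
  -- the composite of the zero field vanishes (homogeneity at the complex background, `c = 0`)
  have hzero : ∀ (B'' : Site d → Fin d → 𝔸) {b'' : ℝ}, 0 ≤ b'' → (∀ x κ', ‖B'' x κ'‖ ≤ b'') → b'' ≤ ρ' →
      linCovIter L (expCfg B'' * U₀) (0 : Site d → Fin d → 𝔸) j z κ = 0 := by
    intro B'' b'' hb'' hB'' hb''ρ
    obtain ⟨hs'', hc'', h1'', -, -⟩ := smallness7_mono (d := d) (L := L) (k := k) (α₀ := α₀) hb''ρ le_rfl hρ.le hsmall' hc₃' hρ'1 hsmall hc₃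
    have h := congrFun (congrFun (linCovIter_cplx_csmul L hL hG k U₀ hU₀ hα hα3 hα8 h52 B'' hb'' hB'' hs'' hc'' h1'' (0 : ℂ)
      (0 : Site d → Fin d → 𝔸) j hj) z) κ
    rwa [zero_smul, Pi.smul_apply, Pi.smul_apply, zero_smul] at h
  have h0' : ∀ x κ', ‖(0 : Site d → Fin d → 𝔸) x κ'‖ ≤ 0 := fun _ _ => by simp
  have eV := hfam (expCfg B' * U₀)
    (hadd_cplx_levels L hL hG k U₀ hU₀ hα hα3 hα8 h52 B' hβ hB' hs' hc' h1')
    (hsmul_cplx_levels L hL hG k U₀ hU₀ hα hα3 hα8 h52 B' hβ hB' hs' hc' h1') (hzero B' hβ hB' hβρ')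
  have eU := hfam U₀ (hadd_levels L hL hG k U₀ hU₀ hα hα3 hα4 h52) (hsmul_levels L hL hG k U₀ hU₀ hα hα3 hα4 h52)
    (by have h := hzero 0 le_rfl h0' hρ'.le; rwa [expCfg_zero_mul] at h)
  rw [eV, eU, ← Finset.sum_sub_distrib, Finset.mul_sum]
  refine (norm_sum_le _ _).trans (Finset.sum_le_sum fun s _ => ?_)
  have h := norm_linCovIter_bump_sub_base_le L hL hG k U₀ hU₀ hα hα3 hα8 h52 hρ' hρ hsmall' hc₃' hρ'1 hE hdX hsmall hc₃ B' hβ hB' hβρ s.1 s.2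
    (B s.1 s.2) hj z κ
  linarith

end Main

end Literature.MathematicalPhysics.QuantumFieldTheory.Balaban1983to89.B7Prop7LinearKernelBackgroundModulus

end
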